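import Summits.Ventures.Crystal3D.Bulk.GapRotationOrder
import Summits.Ventures.Crystal3D.Bulk.GapActiveFaces
import HarnessLib

/-!
# The corner sectors at a vertex of the tight map: a face lies in the sector of its corner,
# two corners' sectors are disjoint — the LOCAL form of P-L3(g) STEP 1 (regions-free)

HONEST FRAMING. Part of the venture `Summits/Ventures/Crystal3D` (cell `pub-crystal3d`, phase 2;
seat typer-bulk-2). Kernel theorems about every configuration satisfying `CensusRows c`; nothing
is claimed about GAP(1.26). Row P-L3(g) of the cell's `DESIGN-L12-THEORY.md` («the tight graph `T′`
is 3-connected; two faces meet in ∅ / one vertex / one edge») is the premise of the plantri class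
of record `-p -c3 -m3 -f6`; its STEP 1 («two distinct faces through two common vertices are the two
sides of the edge joining them») is proved on paper with faces as POINT SETS. This file proves the
LOCAL version of STEP 1 at a vertex `v` WITHOUT point sets, from three kernel facts:

* LEMMA L (`CensusRows.orient3_oface_neg`, `Bulk/GapActiveFaces.lean`): applied to the triples
  `(0,1,n)` and `(1,2,n)` of the walk of a dart `(a, v)` it says that every later vertex `x` of
  that face lies in the OPEN SECTOR at `v` swept counter-clockwise from the arc towards `a` to the
  arc towards `b = onextNbr c v a`:  `0 < orient3 u_v u_a u_x ∧ 0 < orient3 u_v u_x u_b`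
  (**`CensusRows.oface_mem_sector`**);
* `IsGapConfig.not_partner_in_sector` (`Bulk/GapRotationOrder.lean`): no tight partner of `v`
  lies in such a sector ⇒ **`CensusRows.not_mem_tightNbrs_of_oface`**: a vertex of the face of
  `(a, v)` at walk index `≥ 3` is never a tight partner of `v`;
* azimuth bookkeeping (`sector_azimuth_cases`, `not_two_sectors_azimuth`, this file): the
  sectors of two distinct corners at `v` are disjoint ⇒ **`CensusRows.not_mem_two_sectors`** and
  **`CensusRows.oface_vertex_ne_of_ne`**: a ball is a vertex at walk index `≥ 3` of at most ONE
  face at `v`.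

Consumed by `Bulk/GapThreeConnected.lean` (P-L3(g): no separating pair).
-/

noncomputable section

open scoped BigOperators InnerProductSpace RealInnerProductSpace
open Finset Real

namespace Summit.Ventures.Crystal3D

open Literature.Geometry.DiscreteGeometry Function

variable {c : Fin 14 → EuclideanSpace ℝ (Fin 3)}

/-! ## Azimuth bookkeeping for an arbitrary direction -/

/-- **Where a sector lies in azimuth.** For the sorted azimuths `e` of the tight partners of a
ball (values in `(−π, π]`), a position `p` whose gap to the next position is `< π`, and an angle
`θ ∈ (−π, π]` with `sin (θ − e p) > 0` and `sin (e p⁺ − θ) > 0`: either `p` is not the last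
position and `e p < θ < e (p+1)`, or `p` is the last position and `θ > e p ∨ θ < e 0`. -/
theorem sector_azimuth_cases (c : Fin 14 → EuclideanSpace ℝ (Fin 3)) (i : Fin 14) {k : ℕ}
    (hd : (tightAngles c i).card = k + 1) (p : Fin (k + 1)) (hgap : tightGap c i hd p < π)
    {θ : ℝ} (hθ1 : -π < θ) (hθ2 : θ ≤ π)
    (h1 : 0 < Real.sin (θ - sortedTightAngle c i hd p))
    (h2 : 0 < Real.sin (sortedTightAngle c i hd (finRotate (k + 1) p) - θ)) :
    (∃ hp : p ≠ Fin.last k, sortedTightAngle c i hd p < θ ∧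
        θ < sortedTightAngle c i hd (Fin.castPred p hp).succ) ∨
      (p = Fin.last k ∧ (sortedTightAngle c i hd (Fin.last k) < θ ∨ θ < sortedTightAngle c i hd 0)) := by
  have hmono := (sortedTightAngle c i hd).strictMono
  set e := sortedTightAngle c i hd with he
  have bp := sortedTightAngle_mem c i hd p
  have br := sortedTightAngle_mem c i hd (finRotate (k + 1) p)
  have c1 := sin_pos_cases (by linarith [bp.2]) (by linarith [bp.1]) h1
  have c2 := sin_pos_cases (by linarith [br.1]) (by linarith [br.2]) h2
  unfold tightGap at hgap
  by_cases hp : p = Fin.last k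
  · subst hp
    right
    refine ⟨rfl, ?_⟩
    rw [finRotate_last, if_pos rfl] at hgap
    rw [finRotate_last] at c2 br
    rcases c1 with ⟨c1a, -⟩ | c1b
    · left; linarith
    · rcases c2 with ⟨c2a, -⟩ | c2b
      · right; linarith
      · exfalso; linarith [bp.2, br.1]
  · left
    refine ⟨hp, ?_⟩
    rw [if_neg hp, add_zero, finRotate_apply] at hgap
    rw [finRotate_apply] at c2 br
    have hlt : p < Fin.last k := lt_of_le_of_ne (Fin.le_last p) hp
    have hsucc : (Fin.castPred p hp).succ = p + 1 := by
      rw [Fin.ext_iff, Fin.val_succ, Fin.coe_castPred, Fin.val_add_one_of_lt hlt]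
    rw [hsucc]
    have hab : e p < e (p + 1) := hmono (Fin.lt_add_one_iff.2 hlt)
    rcases c1 with ⟨c1a, c1b⟩ | c1c
    · rcases c2 with ⟨c2a, c2b⟩ | c2c
      · constructor <;> linarith
      · exfalso; linarith
    · exfalso
      rcases c2 with ⟨c2a, c2b⟩ | c2c
      · linarith
      · linarith [bp.1, br.2]

/-- **Two corner sectors at a vertex are disjoint in azimuth.** For two distinct positions
`p ≠ p'` with gaps `< π`, no angle `θ ∈ (−π, π]` satisfies the sector conditions of both. -/
theorem not_two_sectors_azimuth (c : Fin 14 → EuclideanSpace ℝ (Fin 3)) (i : Fin 14) {k : ℕ}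
    (hd : (tightAngles c i).card = k + 1) {p p' : Fin (k + 1)} (hpp' : p ≠ p')
    (hgap : tightGap c i hd p < π) (hgap' : tightGap c i hd p' < π) {θ : ℝ} (hθ1 : -π < θ)
    (hθ2 : θ ≤ π) :
    ¬ ((0 < Real.sin (θ - sortedTightAngle c i hd p) ∧
          0 < Real.sin (sortedTightAngle c i hd (finRotate (k + 1) p) - θ)) ∧
        (0 < Real.sin (θ - sortedTightAngle c i hd p') ∧
          0 < Real.sin (sortedTightAngle c i hd (finRotate (k + 1) p') - θ))) := by
  rintro ⟨⟨h1, h2⟩, h1', h2'⟩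
  have hmono := (sortedTightAngle c i hd).strictMono
  set e := sortedTightAngle c i hd with he
  have k1 := sector_azimuth_cases c i hd p hgap hθ1 hθ2 h1 h2
  have k2 := sector_azimuth_cases c i hd p' hgap' hθ1 hθ2 h1' h2'
  -- an inner interval lies inside `[e 0, e last]`
  have inner : ∀ (r : Fin (k + 1)) (hr : r ≠ Fin.last k), e r < θ →
      θ < e (Fin.castPred r hr).succ → e 0 < θ ∧ θ < e (Fin.last k) := by
    intro r hr hlo hhi
    exact ⟨lt_of_le_of_lt (hmono.monotone (Fin.zero_le _)) hlo,
      lt_of_lt_of_le hhi (hmono.monotone (Fin.le_last _))⟩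
  rcases k1 with ⟨hp, lo, hi⟩ | ⟨hp, hw⟩
  · rcases k2 with ⟨hp', lo', hi'⟩ | ⟨hp', hw'⟩
    · -- two inner intervals: disjoint by monotonicity
      rcases lt_or_gt_of_ne hpp' with hlt | hgt
      · have hle : (Fin.castPred p hp).succ ≤ p' := by
          rw [Fin.le_def, Fin.val_succ, Fin.coe_castPred]; exact hlt
        linarith [hmono.monotone hle]
      · have hle : (Fin.castPred p' hp').succ ≤ p := by
          rw [Fin.le_def, Fin.val_succ, Fin.coe_castPred]; exact hgt
        linarith [hmono.monotone hle]
    · obtain ⟨a1, a2⟩ := inner p hp lo hi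
      rcases hw' with h | h <;> linarith
  · rcases k2 with ⟨hp', lo', hi'⟩ | ⟨hp', hw'⟩
    · obtain ⟨a1, a2⟩ := inner p' hp' lo' hi'
      rcases hw with h | h <;> linarith
    · exact hpp' (hp.trans hp'.symm)

/-- A positive product `r · r' · s` with `r > 0`, `r' ≥ 0` has `s > 0`. -/
theorem pos_of_mul_mul_pos' {r r' s : ℝ} (hr : 0 < r) (hr' : 0 ≤ r') (h : 0 < r * r' * s) :
    0 < s := by
  rcases hr'.lt_or_eq with hr' | hr'
  · exact pos_of_mul_mul_pos hr hr' h
  · rw [← hr', mul_zero, zero_mul] at h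
    exact absurd h (lt_irrefl 0)

/-! ## Two corner sectors at a vertex are disjoint -/

/-- **No direction lies in the open sectors of two distinct corners at a vertex.** For an
admissible configuration with `intruderDist² < 3`, a ball `i ≠ 0`, two distinct tight partners
`j ≠ j'` of `i` whose oriented gaps are `< π`, and any ball `u ≠ 0`: the direction `u_u` is NOT
both in the open sector from `j` to `onextNbr c i j` and in the open sector from `j'` to
`onextNbr c i j'` (sector from `a` to `b` at `i`: `0 < orient3 u_i u_a x ∧ 0 < orient3 u_i x u_b`). -/
theorem IsGapConfig.not_mem_two_sectors (hc : IsGapConfig c) (hD3 : intruderDist c ^ 2 < 3)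
    {i j j' u : Fin 14} (hi0 : i ≠ 0) (hu0 : u ≠ 0) (hj : j ∈ tightNbrs c i)
    (hj' : j' ∈ tightNbrs c i) (hjj' : j ≠ j') (hlt : odartGap c i j < π)
    (hlt' : odartGap c i j' < π) :
    ¬ ((0 < orient3 (gapDir c i) (gapDir c j) (gapDir c u) ∧
          0 < orient3 (gapDir c i) (gapDir c u) (gapDir c (onextNbr c i j))) ∧
        (0 < orient3 (gapDir c i) (gapDir c j') (gapDir c u) ∧
          0 < orient3 (gapDir c i) (gapDir c u) (gapDir c (onextNbr c i j')))) := by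
  have hD1 := hc.one_le_intruderDist
  have hD2 : intruderDist c < 2 := by nlinarith
  obtain ⟨k, hd⟩ := hc.exists_card_tightAngles_eq_succ hD3 hi0 ⟨j, hj⟩
  obtain ⟨m, rfl⟩ := hc.exists_tightNbrAt_eq hD3 hi0 hd hj
  obtain ⟨m', rfl⟩ := hc.exists_tightNbrAt_eq hD3 hi0 hd hj'
  have hmm' : m ≠ m' := fun h => hjj' (by rw [h])
  have hj0 := (mem_tightNbrs.1 hj).1
  have hj'0 := (mem_tightNbrs.1 hj').1
  have rj := hc.trad_pos hD2 hi0 hj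
  have rj' := hc.trad_pos hD2 hi0 hj'
  have ru : 0 ≤ trad (gapDir c i) (gapDir c u) := Real.sqrt_nonneg _
  set θ := tightAzimuth c i u with hθ
  have hθ1 : -π < θ := neg_pi_lt_tightAzimuth c i u
  have hθ2 : θ ≤ π := tightAzimuth_le_pi c i u
  rintro ⟨⟨h1, h2⟩, h1', h2'⟩
  rw [hc.orient3_gapDir hi0 hj0 hu0, tightAzimuth_tightNbrAt] at h1
  rw [hc.orient3_gapDir hi0 hj'0 hu0, tightAzimuth_tightNbrAt] at h1'
  unfold odartGap onextNbr at *
  split_ifs at hlt hlt' h2 h2' with h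
  · -- right-handed frame: the successor is the next position
    rw [nextNbr_tightNbrAt hd m] at h2
    rw [nextNbr_tightNbrAt hd m'] at h2'
    rw [dartGap_tightNbrAt hd m] at hlt
    rw [dartGap_tightNbrAt hd m'] at hlt'
    have hn := tightNbrAt_mem c i hd (finRotate (k + 1) m)
    have hn' := tightNbrAt_mem c i hd (finRotate (k + 1) m')
    rw [hc.orient3_gapDir hi0 hu0 (mem_tightNbrs.1 hn).1, h, mul_one, tightAzimuth_tightNbrAt] at h2
    rw [hc.orient3_gapDir hi0 hu0 (mem_tightNbrs.1 hn').1, h, mul_one, tightAzimuth_tightNbrAt]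
      at h2'
    rw [h, mul_one] at h1 h1'
    refine not_two_sectors_azimuth c i hd hmm' hlt hlt' hθ1 hθ2 ⟨⟨?_, ?_⟩, ?_, ?_⟩
    · exact pos_of_mul_mul_pos' rj ru h1
    · rw [mul_comm (trad _ (gapDir c u))] at h2
      exact pos_of_mul_mul_pos' (hc.trad_pos hD2 hi0 hn) ru h2
    · exact pos_of_mul_mul_pos' rj' ru h1'
    · rw [mul_comm (trad _ (gapDir c u))] at h2'
      exact pos_of_mul_mul_pos' (hc.trad_pos hD2 hi0 hn') ru h2'
  · -- left-handed frame: the successor is the previous position `p`, `rot p = m`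
    have h' : frameDet c i = -1 := frameDet_eq_neg_one_of_ne h
    rw [prevNbr_tightNbrAt hd m] at h2 hlt
    rw [prevNbr_tightNbrAt hd m'] at h2' hlt'
    set p := (finRotate (k + 1)).symm m with hp
    set p' := (finRotate (k + 1)).symm m' with hp'
    have hpm : finRotate (k + 1) p = m := Equiv.apply_symm_apply _ _
    have hpm' : finRotate (k + 1) p' = m' := Equiv.apply_symm_apply _ _
    have hpp' : p ≠ p' := fun hh => hmm' (by rw [← hpm, ← hpm', hh])
    rw [dartGap_tightNbrAt hd p] at hlt
    rw [dartGap_tightNbrAt hd p'] at hlt'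
    have hn := tightNbrAt_mem c i hd p
    have hn' := tightNbrAt_mem c i hd p'
    rw [hc.orient3_gapDir hi0 hu0 (mem_tightNbrs.1 hn).1, h', tightAzimuth_tightNbrAt] at h2
    rw [hc.orient3_gapDir hi0 hu0 (mem_tightNbrs.1 hn').1, h', tightAzimuth_tightNbrAt] at h2'
    rw [h'] at h1 h1'
    -- `r r' sin(x) (−1) > 0` gives `sin (−x) > 0`
    have flip : ∀ {r r' x : ℝ}, 0 < r → 0 ≤ r' → 0 < r * r' * Real.sin x * -1 →
        0 < Real.sin (-x) := by
      intro r r' x hr hr' hh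
      rw [Real.sin_neg]
      have : 0 < r * r' * (-Real.sin x) := by linarith
      exact pos_of_mul_mul_pos' hr hr' this
    refine not_two_sectors_azimuth c i hd hpp' hlt hlt' hθ1 hθ2 ⟨⟨?_, ?_⟩, ?_, ?_⟩
    · have := flip (hc.trad_pos hD2 hi0 hn) ru (by rw [mul_comm (trad _ (gapDir c u))] at h2; exact h2)
      rwa [neg_sub] at this
    · have := flip rj ru h1
      rw [neg_sub] at this
      rw [hpm]; exact this
    · have := flip (hc.trad_pos hD2 hi0 hn') ru
        (by rw [mul_comm (trad _ (gapDir c u))] at h2'; exact h2')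
      rwa [neg_sub] at this
    · have := flip rj' ru h1'
      rw [neg_sub] at this
      rw [hpm']; exact this

/-- Under the census socket: no ball's direction lies in the open sectors of two distinct corners
at a vertex. -/
theorem CensusRows.not_mem_two_sectors (h : CensusRows c) {i j j' u : Fin 14} (hi0 : i ≠ 0)
    (hu0 : u ≠ 0) (hj : j ∈ tightNbrs c i) (hj' : j' ∈ tightNbrs c i) (hjj' : j ≠ j') :
    ¬ ((0 < orient3 (gapDir c i) (gapDir c j) (gapDir c u) ∧
          0 < orient3 (gapDir c i) (gapDir c u) (gapDir c (onextNbr c i j))) ∧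
        (0 < orient3 (gapDir c i) (gapDir c j') (gapDir c u) ∧
          0 < orient3 (gapDir c i) (gapDir c u) (gapDir c (onextNbr c i j')))) :=
  h.isGapConfig.not_mem_two_sectors h.intruderDist_bounds.1 hi0 hu0 hj hj' hjj'
    (h.odartGap_lt_pi hi0 hj) (h.odartGap_lt_pi hi0 hj')

/-! ## A face lies in the open sector of its corner -/

/-- The first three tails of the walk of a dart `q = (a, v)`: `a`, `v`, `onextNbr c v a`. -/
theorem fst_iterate_ofaceSucc_two (c : Fin 14 → EuclideanSpace ℝ (Fin 3)) (q : Fin 14 × Fin 14) :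
    ((ofaceSucc c)^[1] q).1 = q.2 ∧ ((ofaceSucc c)^[2] q).1 = onextNbr c q.2 q.1 := by
  refine ⟨rfl, ?_⟩
  rw [show (2 : ℕ) = 1 + 1 from rfl, iterate_succ_apply', iterate_one]
  rfl

/-- **A face lies in the open sector of each of its corners (LEMMA L, local form).** For a dart
`q = (a, v)` of the tight map of a census configuration and a walk index `3 ≤ n < ofaceLen c q`,
the direction of the `n`-th vertex `x` of the face of `q` lies in the OPEN SECTOR at `v` swept
counter-clockwise (seen from outside) from the arc towards `a` to the arc towards
`b = onextNbr c v a`:  `0 < orient3 u_v u_a u_x` and `0 < orient3 u_v u_x u_b`. -/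
theorem CensusRows.oface_mem_sector (h : CensusRows c) {q : Fin 14 × Fin 14} (hq : q ∈ darts c)
    {n : ℕ} (h3 : 3 ≤ n) (hn : n < ofaceLen c q) :
    0 < orient3 (gapDir c q.2) (gapDir c q.1) (gapDir c ((ofaceSucc c)^[n] q).1) ∧
      0 < orient3 (gapDir c q.2) (gapDir c ((ofaceSucc c)^[n] q).1)
        (gapDir c (onextNbr c q.2 q.1)) := by
  obtain ⟨e1, e2⟩ := fst_iterate_ofaceSucc_two c q
  have k1 := h.orient3_oface_neg hq (i := 0) (j := 1) (k := n) (by omega) (by omega) hn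
  have k2 := h.orient3_oface_neg hq (i := 1) (j := 2) (k := n) (by omega) (by omega) hn
  rw [e1, iterate_zero_apply] at k1
  rw [e1, e2] at k2
  constructor
  · rw [orient3_swap_left]; linarith
  · rw [orient3_swap_right]; linarith

/-! ## LOCAL STEP 1 of P-L3(g) -/

/-- **A later vertex of a face is never a tight partner of the corner vertex.** For a dart
`q = (a, v)` and `3 ≤ n < ofaceLen c q`, the `n`-th vertex of the face of `q` is not a tight
partner of `v`: the only vertices of that face adjacent to `v` in the tight graph are its two
walk-neighbours `a` and `onextNbr c v a`. -/
theorem CensusRows.not_mem_tightNbrs_of_oface (h : CensusRows c) {q : Fin 14 × Fin 14}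
    (hq : q ∈ darts c) {n : ℕ} (h3 : 3 ≤ n) (hn : n < ofaceLen c q) :
    ((ofaceSucc c)^[n] q).1 ∉ tightNbrs c q.2 := by
  intro hx
  obtain ⟨hD3, -, -⟩ := h.intruderDist_bounds
  have hv0 : q.2 ≠ 0 := (mem_darts.1 hq).2.1
  have ha : q.1 ∈ tightNbrs c q.2 := by
    have := snd_mem_tightNbrs_of_mem_darts (swap_mem_darts hq)
    simpa only [Prod.fst_swap, Prod.snd_swap] using this
  obtain ⟨e1, e2⟩ := fst_iterate_ofaceSucc_two c q
  have hxa : ((ofaceSucc c)^[n] q).1 ≠ q.1 := by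
    have := h.fst_iterate_ofaceSucc_injOn hq (i := 0) (j := n) (by omega) hn
    rw [iterate_zero_apply] at this
    exact Ne.symm this
  have hxb : ((ofaceSucc c)^[n] q).1 ≠ onextNbr c q.2 q.1 := by
    have := h.fst_iterate_ofaceSucc_injOn hq (i := 2) (j := n) (by omega) hn
    rw [e2] at this
    exact Ne.symm this
  exact h.isGapConfig.not_partner_in_sector hD3 hv0 ha hx hxa hxb (h.odartGap_lt_pi hv0 ha)
    (h.oface_mem_sector hq h3 hn)

/-- **A ball is a later vertex of at most one face at a vertex.** For two darts `q = (a, v)` and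
`q' = (a', v)` into the same vertex with `a ≠ a'` (two distinct corners at `v`) and walk indices
`3 ≤ n < ofaceLen c q`, `3 ≤ n' < ofaceLen c q'`, the `n`-th vertex of the face of `q` and the
`n'`-th vertex of the face of `q'` are different balls. With
`CensusRows.not_mem_tightNbrs_of_oface`: two distinct faces at `v` share a vertex `x ≠ v` only
when `x` is a tight partner of `v` and they are the two sides of the edge `vx` — STEP 1 of
P-L3(g) in local form. -/
theorem CensusRows.oface_vertex_ne_of_ne (h : CensusRows c) {q q' : Fin 14 × Fin 14}
    (hq : q ∈ darts c) (hq' : q' ∈ darts c) (hv : q.2 = q'.2) (ha : q.1 ≠ q'.1) {n n' : ℕ}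
    (h3 : 3 ≤ n) (hn : n < ofaceLen c q) (h3' : 3 ≤ n') (hn' : n' < ofaceLen c q') :
    ((ofaceSucc c)^[n] q).1 ≠ ((ofaceSucc c)^[n'] q').1 := by
  intro hx
  obtain ⟨hD3, -, -⟩ := h.intruderDist_bounds
  have hv0 : q.2 ≠ 0 := (mem_darts.1 hq).2.1
  have hu0 : ((ofaceSucc c)^[n] q).1 ≠ 0 :=
    (mem_darts.1 (h.isGapConfig.iterate_ofaceSucc_mem_darts hD3 hq n)).1
  have haN : q.1 ∈ tightNbrs c q.2 := by
    have := snd_mem_tightNbrs_of_mem_darts (swap_mem_darts hq)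
    simpa only [Prod.fst_swap, Prod.snd_swap] using this
  have haN' : q'.1 ∈ tightNbrs c q.2 := by
    have := snd_mem_tightNbrs_of_mem_darts (swap_mem_darts hq')
    rw [hv]
    simpa only [Prod.fst_swap, Prod.snd_swap] using this
  have s1 := h.oface_mem_sector hq h3 hn
  have s2 := h.oface_mem_sector hq' h3' hn'
  rw [← hv, ← hx] at s2
  exact h.not_mem_two_sectors hv0 hu0 haN haN' ha ⟨s1, s2⟩

end Summit.Ventures.Crystal3D
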